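import Literature.Computability.QuantumComplexity.RazTalBlocks
import HarnessLib

/-!
# Classical-and-oracle programs act classically on basis states

Topic `Literature/Computability/QuantumComplexity`; second tool file of the `BQP^O` machine for
Simon's algorithm on the level encoding (hypothesis `SimonLevelMachine` of
`Literature/Barriers/QuantumAdvantage/PPolyOraclesThm76Simon.lean`). The middle segment of Simon's
Fourier-twice circuit — copy the query register, XOR the oracle bits `[qryStr n y i ∈ A]` into the
value register, uncopy — consists of classical reversible operations and oracle queries only; such
`RtOp` programs (`RazTalBlocks.lean`: `RtOp.cl`, `RtOp.oracle`, compiled by `RtOp.compileList`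
into Clifford+T gates with XOR oracle gates) map basis states to basis states, by the classical
evaluation `coEval A` defined here:

* `RtOp.coStep A op w`, `coEval A ops w` — the basis label after one operation / a program
  (`ClOp.eval` for classical operations; the answer wire XORed with `[w(qs) ∈ A]` for a query;
  Hadamard-type operations, absent from such segments, are read as the identity);
* `RtOp.IsCO` (the operation is classical or a query) and **`compileList_mulVec_basisState_of_isCO`**:
  `⟦compileList ops⟧_A |w⟩ = |coEval A ops w⟩` (from `RevOp.compile_mulVec_basisState` and
  `placeGate_oracleGate_mulVec_basisState`);
* bookkeeping for the Simon segment: `coEval_append`, programs that never target a wire leave it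
  alone (`coEval_apply_of_forall_ne`), a run of `CNOT`s copying a register onto fresh wires
  (`coEval_copies`), and a run of queries with pairwise distinct fresh answer wires, none of them
  queried (`coEval_queries`: every answer wire receives its oracle bit, nothing else moves).

## References

* M. A. Nielsen, I. L. Chuang, *Quantum Computation and Quantum Information*, CUP 2010, §4.3,
  §6.1.1 Eq. (6.2) (`|q, b⟩ ↦ |q, b ⊕ f(q)⟩`) [NielsenChuang2010].
* S. Arora, B. Barak, *Computational Complexity*, CUP 2009, §10.3.7, Lemma 10.10 [AroraBarak2009].
-/

noncomputable section

namespace Literature.Computability.QuantumComplexity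

open Matrix _root_.Computability Complexity Cryptography Finset

namespace RazTalMachine.RtOp

variable {N : ℕ}

/-- The operation is classical or an oracle query (no Hadamard-type gate). [folklore] -/
def IsCO : RtOp (Fin N) → Prop
  | cl _ => True
  | had _ => False
  | chad _ _ => False
  | oracle _ _ => True

/-- **One classical-or-oracle operation on a basis label**: classical operations act by
`ClOp.eval`, a query XORs its answer wire with `[w(qs) ∈ A]`; Hadamard-type operations (not
covered by the basis-state calculus) are read as the identity. [cite: NielsenChuang2010, §6.1.1 Eq. (6.2)] -/
def coStep (A : Language Bool) : RtOp (Fin N) → QReg N → QReg N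
  | cl op, w => op.eval w
  | had _, w => w
  | chad _ _, w => w
  | oracle qs t, w => Function.update w t (w t ^^ A.boolIndicator (qs.map w))

/-- **A classical-or-oracle program on a basis label** (operations applied head first). [folklore] -/
def coEval (A : Language Bool) : List (RtOp (Fin N)) → QReg N → QReg N
  | [], w => w
  | op :: ops, w => coEval A ops (coStep A op w)

/-- `coEval` of a `cons`. [folklore] -/
@[simp] theorem coEval_cons (A : Language Bool) (op : RtOp (Fin N)) (ops : List (RtOp (Fin N))) (w : QReg N) :
    coEval A (op :: ops) w = coEval A ops (coStep A op w) := rfl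

/-- `coEval` of the empty program. [folklore] -/
@[simp] theorem coEval_nil (A : Language Bool) (w : QReg N) : coEval A ([] : List (RtOp (Fin N))) w = w := rfl

/-- `coEval` of a concatenation. [folklore] -/
theorem coEval_append (A : Language Bool) (ops ops' : List (RtOp (Fin N))) (w : QReg N) :
    coEval A (ops ++ ops') w = coEval A ops' (coEval A ops w) := by
  induction ops generalizing w with
  | nil => rfl
  | cons op ops ih => exact ih _

/-- The query string read by `oracleEmb qs t h` off the basis label `w` is `qs.map w`. [folklore] -/
theorem queryOf_oracleEmb (qs : List (Fin N)) (t : Fin N) (h : (qs ++ [t]).Nodup) (w : QReg N) :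
    queryOf (oracleEmb qs t h) w = qs.map w := by
  unfold queryOf
  apply List.ext_getElem (by simp)
  intro i h1 h2
  rw [List.getElem_ofFn, List.getElem_map, oracleEmb_castSucc]

/-- **A compiled classical-or-oracle operation acts on basis states by `coStep`.**
[cite: NielsenChuang2010, §4.3 and §6.1.1] [cite: AroraBarak2009, §10.3.7 Lemma 10.10] -/
theorem compile_mulVec_basisState_of_isCO (A : Language Bool) (op : RtOp (Fin N)) (h : op.WF) (hco : op.IsCO) (w : QReg N) :
    (⟨op.compile h⟩ : QCircuit cliffordT N).toMatrix A *ᵥ basisState w = basisState (coStep A op w) := by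
  cases op with
  | cl op =>
    show (⟨(op.toRev h).compile⟩ : QCircuit cliffordT N).toMatrix A *ᵥ basisState w = basisState (op.eval w)
    rw [RevOp.compile_mulVec_basisState, ClOp.eval_toRev]
  | had a => exact absurd hco id
  | chad c a => exact absurd hco id
  | oracle qs t =>
    show (⟨[QGate.oracle qs.length (oracleEmb qs t h)]⟩ : QCircuit cliffordT N).toMatrix A *ᵥ basisState w = _
    rw [QCircuit.toMatrix_cons, QCircuit.toMatrix_nil, Matrix.one_mul]
    show placeGate (oracleEmb qs t h) (oracleGate A qs.length) *ᵥ basisState w = _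
    rw [placeGate_oracleGate_mulVec_basisState, oracleTarget, oracleEmb_last, queryOf_oracleEmb]
    rfl

/-- **A compiled classical-or-oracle program acts on basis states by `coEval`.**
[cite: NielsenChuang2010, §4.3 and §6.1.1] -/
theorem compileList_mulVec_basisState_of_isCO (A : Language Bool) :
    ∀ (ops : List (RtOp (Fin N))) (h : ∀ op ∈ ops, op.WF) (_hco : ∀ op ∈ ops, op.IsCO) (w : QReg N),
      (⟨compileList ops h⟩ : QCircuit cliffordT N).toMatrix A *ᵥ basisState w = basisState (coEval A ops w)
  | [], _, _, w => by simp [compileList]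
  | op :: ops, h, hco, w => by
    rw [compileList_cons, toMatrix_mk_append, ← Matrix.mulVec_mulVec,
      compile_mulVec_basisState_of_isCO A op _ (hco op (by simp)), coEval_cons]
    exact compileList_mulVec_basisState_of_isCO A ops _ (fun o ho => hco o (by simp [ho])) _

/-! ### Bookkeeping: untouched wires, copies, queries -/

/-- The wire written by a classical-or-oracle operation (`none` for Hadamard-type operations). [folklore] -/
def tgt : RtOp (Fin N) → Option (Fin N)
  | cl op => some op.target
  | had _ => none
  | chad _ _ => none
  | oracle _ t => some t

/-- One operation changes at most its written wire. [folklore] -/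
theorem coStep_apply_of_ne (A : Language Bool) (op : RtOp (Fin N)) (w : QReg N) {p : Fin N} (hp : op.tgt ≠ some p) :
    coStep A op w p = w p := by
  cases op with
  | cl op =>
    have hne : p ≠ op.target := fun e => hp (by rw [e]; rfl)
    simp [coStep, ClOp.eval, hne]
  | had a => rfl
  | chad c a => rfl
  | oracle qs t =>
    have hne : p ≠ t := fun e => hp (by rw [e]; rfl)
    simp [coStep, hne]

/-- **A program that never writes wire `p` leaves it alone.** [folklore] -/
theorem coEval_apply_of_forall_ne (A : Language Bool) (ops : List (RtOp (Fin N))) (w : QReg N) {p : Fin N}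
    (hp : ∀ op ∈ ops, op.tgt ≠ some p) : coEval A ops w p = w p := by
  induction ops generalizing w with
  | nil => rfl
  | cons op ops ih =>
    rw [coEval_cons, ih _ (fun o ho => hp o (by simp [ho])), coStep_apply_of_ne A op w (hp op (by simp))]

/-- **Copying a register onto fresh wires**: the `CNOT`s `src j → dst j` (`j < k`, all `dst j`
distinct, no `dst j` among the sources) set `dst j` to `w (dst j) ⊕ w (src j)` and move nothing else.
[cite: NielsenChuang2010, §1.3.1 (CNOT as a copier of basis states)] -/
theorem coEval_copies (A : Language Bool) {k : ℕ} (src dst : Fin k → Fin N) (hdst : Function.Injective dst)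
    (hsd : ∀ i j, src i ≠ dst j) (w : QReg N) :
    coEval A ((List.finRange k).map fun j => cl (ClOp.cnot (src j) (dst j))) w =
      fun p => if h : ∃ j, dst j = p then w p ^^ w (src h.choose) else w p := by
  classical
  -- induction over an arbitrary list of indices with distinct destinations
  suffices H : ∀ (l : List (Fin k)) (hl : l.Nodup) (w : QReg N),
      coEval A (l.map fun j => cl (ClOp.cnot (src j) (dst j))) w =
        fun p => if h : ∃ j ∈ l, dst j = p then w p ^^ w (src h.choose) else w p by
    rw [H _ (List.nodup_finRange k)]
    funext p
    by_cases h : ∃ j, dst j = p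
    · have h' : ∃ j ∈ List.finRange k, dst j = p := by obtain ⟨j, hj⟩ := h; exact ⟨j, List.mem_finRange j, hj⟩
      rw [dif_pos h', dif_pos h]
      have e1 := h'.choose_spec.2
      have e2 := h.choose_spec
      rw [hdst (e1.trans e2.symm)]
    · have h' : ¬ ∃ j ∈ List.finRange k, dst j = p := fun ⟨j, _, hj⟩ => h ⟨j, hj⟩
      rw [dif_neg h', dif_neg h]
  intro l hl
  induction l with
  | nil => intro w; funext p; simp
  | cons j l ih =>
    intro w
    rw [List.map_cons, coEval_cons, ih (List.nodup_cons.1 hl).2]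
    have hjl : j ∉ l := (List.nodup_cons.1 hl).1
    -- the first CNOT
    have hstep : coStep A (cl (ClOp.cnot (src j) (dst j))) w = Function.update w (dst j) (w (dst j) ^^ w (src j)) := by
      simp [coStep, ClOp.eval, ClOp.target, ClOp.guard]
    rw [hstep]
    funext p
    by_cases hp : ∃ j' ∈ l, dst j' = p
    · obtain ⟨j', hj', hj'p⟩ := hp
      have hpj : p ≠ dst j := fun e => hjl (by rwa [← hdst (hj'p.trans e)])
      have h1 : ∃ j'' ∈ l, dst j'' = p := ⟨j', hj', hj'p⟩
      have h2 : ∃ j'' ∈ j :: l, dst j'' = p := ⟨j', List.mem_cons_of_mem _ hj', hj'p⟩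
      rw [dif_pos h1, dif_pos h2, Function.update_of_ne hpj,
        Function.update_of_ne (fun e => hsd _ _ e)]
      have e1 := h1.choose_spec.2
      have e2 := h2.choose_spec.2
      rw [hdst (e1.trans e2.symm)]
    · rw [dif_neg hp]
      by_cases hpj : p = dst j
      · subst hpj
        have h2 : ∃ j'' ∈ j :: l, dst j'' = dst j := ⟨j, List.mem_cons_self, rfl⟩
        rw [dif_pos h2, Function.update_self]
        have e2 := hdst h2.choose_spec.2
        rw [e2]
      · have h2 : ¬ ∃ j'' ∈ j :: l, dst j'' = p := by
          rintro ⟨j'', hj'', e⟩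
          rcases List.mem_cons.1 hj'' with rfl | hmem
          · exact hpj e.symm
          · exact hp ⟨j'', hmem, e⟩
        rw [dif_neg h2, Function.update_of_ne hpj]

/-- **A run of queries with pairwise distinct fresh answer wires, none of them queried**: every
answer wire `t c` receives `w (t c) ⊕ [qs c (read off w) ∈ A]`, and nothing else moves.
[cite: NielsenChuang2010, §6.1.1 Eq. (6.2)] -/
theorem coEval_queries (A : Language Bool) {k : ℕ} (qs : Fin k → List (Fin N)) (t : Fin k → Fin N)
    (ht : Function.Injective t) (hqt : ∀ c c', t c ∉ qs c') (w : QReg N) :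
    coEval A ((List.finRange k).map fun c => oracle (qs c) (t c)) w =
      fun p => if h : ∃ c, t c = p then w p ^^ A.boolIndicator ((qs h.choose).map w) else w p := by
  classical
  suffices H : ∀ (l : List (Fin k)) (hl : l.Nodup) (w : QReg N) (w₀ : QReg N)
      (_hw : ∀ c p, p ∈ qs c → w p = w₀ p),
      coEval A (l.map fun c => oracle (qs c) (t c)) w =
        fun p => if h : ∃ c ∈ l, t c = p then w p ^^ A.boolIndicator ((qs h.choose).map w₀) else w p by
    rw [H _ (List.nodup_finRange k) w w (fun _ _ _ => rfl)]
    funext p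
    by_cases h : ∃ c, t c = p
    · have h' : ∃ c ∈ List.finRange k, t c = p := by obtain ⟨c, hc⟩ := h; exact ⟨c, List.mem_finRange c, hc⟩
      rw [dif_pos h', dif_pos h, ht (h'.choose_spec.2.trans h.choose_spec.symm)]
    · have h' : ¬ ∃ c ∈ List.finRange k, t c = p := fun ⟨c, _, hc⟩ => h ⟨c, hc⟩
      rw [dif_neg h', dif_neg h]
  intro l hl
  induction l with
  | nil => intro w w₀ _; funext p; simp
  | cons c l ih =>
    intro w w₀ hw
    rw [List.map_cons, coEval_cons]
    have hcl : c ∉ l := (List.nodup_cons.1 hl).1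
    have hstep : coStep A (oracle (qs c) (t c)) w = Function.update w (t c) (w (t c) ^^ A.boolIndicator ((qs c).map w₀)) := by
      simp only [coStep]
      rw [show (qs c).map w = (qs c).map w₀ from List.map_congr_left fun p hp => hw c p hp]
    rw [hstep, ih (List.nodup_cons.1 hl).2 _ w₀ (fun c' p hp => by
      have hne : p ≠ t c := by rintro rfl; exact hqt c c' hp
      rw [Function.update_of_ne hne, hw c' p hp])]
    funext p
    by_cases hp : ∃ c' ∈ l, t c' = p
    · obtain ⟨c', hc', hc'p⟩ := hp
      have hpc : p ≠ t c := fun e => hcl (by rwa [← ht (hc'p.trans e)])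
      have h1 : ∃ c'' ∈ l, t c'' = p := ⟨c', hc', hc'p⟩
      have h2 : ∃ c'' ∈ c :: l, t c'' = p := ⟨c', List.mem_cons_of_mem _ hc', hc'p⟩
      rw [dif_pos h1, dif_pos h2, Function.update_of_ne hpc, ht (h1.choose_spec.2.trans h2.choose_spec.2.symm)]
    · rw [dif_neg hp]
      by_cases hpc : p = t c
      · subst hpc
        have h2 : ∃ c'' ∈ c :: l, t c'' = t c := ⟨c, List.mem_cons_self, rfl⟩
        rw [dif_pos h2, Function.update_self, ht h2.choose_spec.2]
      · have h2 : ¬ ∃ c'' ∈ c :: l, t c'' = p := by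
          rintro ⟨c'', hc'', e⟩
          rcases List.mem_cons.1 hc'' with rfl | hmem
          · exact hpc e.symm
          · exact hp ⟨c'', hmem, e⟩
        rw [dif_neg h2, Function.update_of_ne hpc]

end RazTalMachine.RtOp

end Literature.Computability.QuantumComplexity

end
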